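import Summits.AnomalousDissipation.AnomalousDissipation.Theorems.NeutralTaylorWavesTaylorWaveQuasiSteadyStubResidualTransferW
import Summits.AnomalousDissipation.AnomalousDissipation.Theorems.NeutralTaylorWavesTaylorWaveQuasiSteadyStubDissipationLawW

/-!
# The ε-free formal hierarchy of the line `windfibred` — vocabulary
# (crux `NeutralTaylorWaves.TaylorWaveQuasiSteady`, stmt-AnomalousDissipation-16293)

Definitions-only support file for revision 3 of the lead's skeleton `Cruxes/TaylorWaveQuasiSteady/Lines/windfibred.lean`.
Revision 2 reduced the crux, by landed theorems, to the single registered stub `stub_profilesW` (profiles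
`P, Q : T⁴ → ·` at every level `n`, with two-scale residual `‖tsResidual (epsN n) …‖² ≤ C ν_n^K`).  Revision 3
factors `stub_profilesW` through the POLYNOMIAL ANSATZ `P = ∑_{a ≤ N} ε^a P_a`, `Q = ∑_{a ≤ N} ε^a Q_a`,
`c = ∑_{a ≤ N} ε^a c_a`: the two-scale operators are Laurent polynomials in `ε` (`D^ε_i = ∂ᵢ + ε⁻¹ kᵢ ∂_θ`), so
`ε · tsResidual ε (∑ ε^a P_a) (∑ ε^a Q_a) (∑ ε^a c_a) = ∑_s ε^s M_s` and `ε · tsDiv ε (∑ ε^a P_a) = ∑_s ε^s d_s`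
with ε-FREE coefficient profiles `M_s = hierarchyCoeff … s`, `d_s = divCoeff … s` (finite sums of slow
derivatives `sDeriv i = ∂_{xᵢ}` and weighted fast derivatives `fDeriv i = kᵢ(x) ∂_θ` of the `P_a, Q_a`).  The
steady monophase BKW hierarchy to order `N` is the system `M_s = 0 (s ≤ N)`, `d_s = 0 (s ≤ N + 1)` — no `ε`, no
`n`: this is the open core of the crux in its natural (Cheverry–Guès–Métivier) form, and the subject of the
registered stub `stub_hierarchyW`; the registered stubs `stub_formalExpansionW` (the two expansions above, pure
algebra) and `stub_truncationW` (formal solutions ⇒ `stub_profilesW`, bookkeeping on the compact torus) carry it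
back.  (No Prop-valued abbreviation is introduced: D-0027 §2.1 reserves propositions under `Summit.*` to registered
obligations, so the three stub statements are spelled out verbatim wherever they occur.)

Contents (namespace `…Theorems.TaylorWaveQuasiSteady`, next to `tsDeriv`, `tsResidual`, … of the Line file):
* `sDeriv i Φ` — slow derivative `∂_{xᵢ} Φ` of a profile on `T⁴` (`i : Fin 3`, coordinate `i.castSucc`);
* `fDeriv j G i Φ` — weighted fast derivative `kᵢ(x) ∂_θ Φ`, `k = ∇G + j` (`phaseGrad`), so that
  `tsDeriv ε j G i Φ y = sDeriv i Φ y + ε⁻¹ • fDeriv j G i Φ y` (by `mul_smul`);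
* `divCoeff j G N P s` — coefficient of `ε^s` in `ε · tsDiv ε j G (∑_{a<N+1} ε^a P_a)`;
* `hierarchyCoeff j G f N P Q c s` — coefficient of `ε^s` in
  `ε · tsResidual ε j G f (∑_{a<N+1} ε^a P_a) (∑_{a<N+1} ε^a Q_a) (∑_{a<N+1} ε^a c_a)`;
* `hierarchy_glue` — the registered composition of revision 3 (§3).
The coefficient of `ε^s` is written as a sum over ALL index pairs `a, b < N + 1` with indicators `if a + b + 1 = s`
etc. (rather than over antidiagonals), which makes the expansion identities a matter of `Finset.sum_comm` and
`Finset.sum_ite_eq`, and keeps second-order terms as COMPOSITIONS `sDeriv i (fDeriv j G i Φ)` (no product rule is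
built in).  Dictionary with the usual BKW notation (`R_r` = coefficient of `ε^r` of the residual itself):
`M_s = R_{s-1}`; `M_0 = 0` is the eikonal/polarisation order `ε⁻¹`, `M_1 = 0` the order `ε⁰` (it contains `f`), etc.

Nothing is asserted here except the composition `hierarchy_glue` (pure logic over landed theorems).  References: Cheverry–Guès–Métivier, Ann. Sci. ENS 36
(2003) §2 (profile equations of large-amplitude monophase oscillations); Cheverry, Bull. SMF 134 (2006) §2; the line
card `Cruxes/TaylorWaveQuasiSteady/Lines/windfibred.md`; lead notes `Cruxes/TaylorWaveQuasiSteady/NOTES.md`.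
-/

-- `Summit.<Summit>.<Problem>` is the tree's mandated summit-side namespace (CONVENTIONS §2); for this
-- single-conjunct summit the two coincide, so the duplicate is deliberate.
set_option linter.dupNamespace false

noncomputable section

open scoped BigOperators
open Literature.Analysis.FunctionSpaces

namespace Summit.AnomalousDissipation.AnomalousDissipation.Theorems.TaylorWaveQuasiSteady

variable {F : Type*} [NormedAddCommGroup F] [NormedSpace ℝ F]

/-! ## §1 Slow and fast derivatives -/

/-- The SLOW partial derivative `∂_{xᵢ} Φ` (`i : Fin 3`) of a profile `Φ` on `T⁴ = T³ × T¹`: the torus partial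
derivative along the coordinate `i.castSucc`. [folklore] -/
def sDeriv (i : Fin 3) (Φ : UnitAddTorus (Fin 4) → F) (y : UnitAddTorus (Fin 4)) : F :=
  Torus.partialDeriv i.castSucc Φ y

/-- The WEIGHTED FAST derivative `kᵢ(x) ∂_θ Φ` of a profile `Φ` on `T⁴`, `k = ∇G + j = phaseGrad j G` read at the
slow point, `θ` the last coordinate; `ε⁻¹ • fDeriv` is the singular part of the two-scale derivative `tsDeriv`.
[folklore] -/
def fDeriv (j : Fin 3 → ℤ) (G : UnitAddTorus (Fin 3) → ℝ) (i : Fin 3) (Φ : UnitAddTorus (Fin 4) → F)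
    (y : UnitAddTorus (Fin 4)) : F :=
  phaseGrad j G i (slow y) • Torus.partialDeriv (Fin.last 3) Φ y

/-! ## §2 The ε-free coefficient profiles -/

/-- **Formal two-scale divergence, coefficient of `ε^s`** in `ε · tsDiv ε j G (∑_{a<N+1} ε^a P_a)`:
`d_s = ∑_{a<N+1} ( [a+1 = s] ∑ᵢ (∂_{xᵢ} P_a)ᵢ + [a = s] ∑ᵢ (kᵢ ∂_θ P_a)ᵢ )`, i.e. `d_0 = k·∂_θP_0`,
`d_s = div_x P_{s-1} + k·∂_θ P_s` (`1 ≤ s ≤ N`), `d_{N+1} = div_x P_N`. [folklore] -/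
def divCoeff (j : Fin 3 → ℤ) (G : UnitAddTorus (Fin 3) → ℝ) (N : ℕ)
    (P : ℕ → UnitAddTorus (Fin 4) → EuclideanSpace ℝ (Fin 3)) (s : ℕ) (y : UnitAddTorus (Fin 4)) : ℝ :=
  ∑ a ∈ Finset.range (N + 1),
    ((if a + 1 = s then ∑ i : Fin 3, (sDeriv i (P a) y) i else 0) +
      (if a = s then ∑ i : Fin 3, (fDeriv j G i (P a) y) i else 0))

/-- **Formal steady two-scale residual, coefficient of `ε^s`** in
`ε · tsResidual ε j G f (∑_{a<N+1} ε^a P_a) (∑_{a<N+1} ε^a Q_a) (∑_{a<N+1} ε^a c_a)`, term by term as in `tsResidual`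
(`convect − ε²·laplacian + grad − c·D_2 − f ∘ slow`):
* convection `∑_{a,b} ( [a+b+1 = s] ∑ₗ (P_a)ₗ ∂_{xₗ} P_b + [a+b = s] ∑ₗ (P_a)ₗ kₗ∂_θ P_b )`;
* minus viscosity `∑_a ( [a+3 = s] ∑ᵢ ∂ᵢ∂ᵢ P_a + [a+2 = s] ∑ᵢ (∂ᵢ(kᵢ∂_θ P_a) + kᵢ∂_θ ∂ᵢ P_a) + [a+1 = s] ∑ᵢ kᵢ∂_θ(kᵢ∂_θ P_a) )`;
* plus pressure `∑_a ( [a+1 = s] ∇_x Q_a + [a = s] k ∂_θ Q_a )`;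
* minus drift `∑_{a,b} ( [a+b+1 = s] c_a ∂_{x₂} P_b + [a+b = s] c_a k₂∂_θ P_b )`;
* minus force `[s = 1] f(x)`.
So `M_0 = ∑ₗ(P_0)ₗkₗ∂_θP_0 + k∂_θQ_0 − c_0k₂∂_θP_0` (eikonal/polarisation order) and `M_1 = 0` is the order-`ε⁰`
equation carrying `f`. [folklore] -/
def hierarchyCoeff (j : Fin 3 → ℤ) (G : UnitAddTorus (Fin 3) → ℝ)
    (f : UnitAddTorus (Fin 3) → EuclideanSpace ℝ (Fin 3)) (N : ℕ)
    (P : ℕ → UnitAddTorus (Fin 4) → EuclideanSpace ℝ (Fin 3)) (Q : ℕ → UnitAddTorus (Fin 4) → ℝ) (c : ℕ → ℝ)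
    (s : ℕ) (y : UnitAddTorus (Fin 4)) : EuclideanSpace ℝ (Fin 3) :=
  (∑ a ∈ Finset.range (N + 1), ∑ b ∈ Finset.range (N + 1),
      ((if a + b + 1 = s then ∑ l : Fin 3, (P a y) l • sDeriv l (P b) y else 0) +
        (if a + b = s then ∑ l : Fin 3, (P a y) l • fDeriv j G l (P b) y else 0)))
  - (∑ a ∈ Finset.range (N + 1),
      ((if a + 3 = s then ∑ i : Fin 3, sDeriv i (sDeriv i (P a)) y else 0) +
        (if a + 2 = s then ∑ i : Fin 3, (sDeriv i (fDeriv j G i (P a)) y + fDeriv j G i (sDeriv i (P a)) y)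
          else 0) +
        (if a + 1 = s then ∑ i : Fin 3, fDeriv j G i (fDeriv j G i (P a)) y else 0)))
  + (∑ a ∈ Finset.range (N + 1),
      WithLp.toLp 2 (fun i : Fin 3 =>
        (if a + 1 = s then sDeriv i (Q a) y else 0) + (if a = s then fDeriv j G i (Q a) y else 0)))
  - (∑ a ∈ Finset.range (N + 1), ∑ b ∈ Finset.range (N + 1),
      ((if a + b + 1 = s then c a • sDeriv 2 (P b) y else 0) +
        (if a + b = s then c a • fDeriv j G 2 (P b) y else 0)))
  - (if s = 1 then f (slow y) else 0)



/-! ## §3 The composition of revision 3 -/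

/-- **Hierarchy glue** (the registered sub-goal `hierarchy_glue` of stmt-AnomalousDissipation-16293; kernel-checked, no
`sorry`): IF the ε-free formal hierarchy is solvable to every order (the statement of the registered stub `stub_hierarchyW`,
verbatim) AND formal solvability implies the profile-level statement of `stub_profilesW` (which is what the registered stubs
`stub_formalExpansionW` and `stub_truncationW` give: `stub_truncationW stub_formalExpansionW`), THEN the crux
`…Theses.NeutralTaylorWaves.TaylorWaveQuasiSteady` holds BY NAME — through the landed `TaylorWaveQuasiSteady_of` (p158245)
with the landed `DissipationLaw.stub_dissipationLawW` (p160604) and `ResidualTransfer.stub_residualTransferW` (p159632).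
[folklore] -/
theorem hierarchy_glue : (∃ (j : Fin 3 → ℤ) (i₀ : Fin 3) (G : UnitAddTorus (Fin 3) → ℝ) (f : UnitAddTorus (Fin 3) → EuclideanSpace ℝ (Fin 3)) (E ε₀ : ℝ), j i₀ ≠ 0 ∧ Literature.Analysis.FunctionSpaces.Torus.IsSmooth G ∧ (∀ x, Literature.Analysis.FunctionSpaces.Torus.partialDeriv i₀ G x = 0) ∧ Literature.Analysis.FunctionSpaces.Torus.IsSmooth f ∧ Literature.Analysis.FunctionSpaces.Torus.IsDivFree f ∧ Literature.Analysis.FunctionSpaces.Torus.HasZeroMean f ∧ 0 < ε₀ ∧ ∀ N : ℕ, ∃ (P : ℕ → UnitAddTorus (Fin 4) → EuclideanSpace ℝ (Fin 3)) (Q : ℕ → UnitAddTorus (Fin 4) → ℝ) (c : ℕ → ℝ), (∀ a, Literature.Analysis.FunctionSpaces.Torus.IsSmooth (P a)) ∧ (∀ a, Literature.Analysis.FunctionSpaces.Torus.IsSmooth (Q a)) ∧ (∀ a y, sDeriv i₀ (P a) y = 0) ∧ (∀ a, (∫ y, P a y) 0 = 0 ∧ (∫ y, P a y) 1 = 0)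 ∧ (∀ y, ‖P 0 y‖ ^ 2 ≤ E) ∧ (∫ y, dissDensity j G (P 0) y) = ε₀ ∧ (∀ s, s ≤ N + 1 → ∀ y, divCoeff j G N P s y = 0) ∧ (∀ s, s ≤ N → ∀ y, hierarchyCoeff j G f N P Q c s y = 0)) → ((∃ (j : Fin 3 → ℤ) (i₀ : Fin 3) (G : UnitAddTorus (Fin 3) → ℝ) (f : UnitAddTorus (Fin 3) → EuclideanSpace ℝ (Fin 3)) (E ε₀ : ℝ), j i₀ ≠ 0 ∧ Literature.Analysis.FunctionSpaces.Torus.IsSmooth G ∧ (∀ x, Literature.Analysis.FunctionSpaces.Torus.partialDeriv i₀ G x = 0) ∧ Literature.Analysis.FunctionSpaces.Torus.IsSmooth f ∧ Literature.Analysis.FunctionSpaces.Torus.IsDivFree f ∧ Literature.Analysis.FunctionSpaces.Torus.HasZeroMean f ∧ 0 < ε₀ ∧ ∀ N : ℕ, ∃ (P : ℕ → UnitAddTorus (Fin 4) → EuclideanSpace ℝ (Fin 3)) (Q : ℕ → UnitAddTorus (Fin 4) → ℝ) (c : ℕ → ℝ), (∀ a, Literature.Analysis.FunctionSpaces.Torus.IsSmooth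 (P a)) ∧ (∀ a, Literature.Analysis.FunctionSpaces.Torus.IsSmooth (Q a)) ∧ (∀ a y, sDeriv i₀ (P a) y = 0) ∧ (∀ a, (∫ y, P a y) 0 = 0 ∧ (∫ y, P a y) 1 = 0) ∧ (∀ y, ‖P 0 y‖ ^ 2 ≤ E) ∧ (∫ y, dissDensity j G (P 0) y) = ε₀ ∧ (∀ s, s ≤ N + 1 → ∀ y, divCoeff j G N P s y = 0) ∧ (∀ s, s ≤ N → ∀ y, hierarchyCoeff j G f N P Q c s y = 0)) → (∃ (j : Fin 3 → ℤ) (i₀ : Fin 3) (G : UnitAddTorus (Fin 3) → ℝ) (f : UnitAddTorus (Fin 3) → EuclideanSpace ℝ (Fin 3)) (E ε₀ : ℝ), j i₀ ≠ 0 ∧ Literature.Analysis.FunctionSpaces.Torus.IsSmooth G ∧ (∀ x, Literature.Analysis.FunctionSpaces.Torus.partialDeriv i₀ G x = 0) ∧ Literature.Analysis.FunctionSpaces.Torus.IsSmooth f ∧ Literature.Analysis.FunctionSpaces.Torus.IsDivFree f ∧ Literature.Analysis.FunctionSpaces.Torus.HasZeroMean f ∧ 0 < ε₀ ∧ ∀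 K : ℕ, ∃ C : ℝ, ∀ n : ℕ, ∃ (P : UnitAddTorus (Fin 4) → EuclideanSpace ℝ (Fin 3)) (Q : UnitAddTorus (Fin 4) → ℝ) (c : ℝ), Literature.Analysis.FunctionSpaces.Torus.IsSmooth P ∧ Literature.Analysis.FunctionSpaces.Torus.IsSmooth Q ∧ |c| ≤ C ∧ (∀ y, ‖P y‖ ^ 2 ≤ E) ∧ (∀ (i : Fin 3) y, ‖Literature.Analysis.FunctionSpaces.Torus.partialDeriv i.castSucc P y‖ ≤ C) ∧ (∀ y, ‖Literature.Analysis.FunctionSpaces.Torus.partialDeriv (Fin.last 3) P y‖ ≤ C) ∧ (∀ (i : Fin 3) y, ‖Literature.Analysis.FunctionSpaces.Torus.partialDeriv i.castSucc (Literature.Analysis.FunctionSpaces.Torus.partialDeriv (Fin.last 3) P) y‖ ≤ C) ∧ |(∫ y, dissDensity j G P y) - ε₀| ≤ C * epsN n ∧ (∫ x, P (phaseMap j G n x)) 0 = 0 ∧ (∫ x, P (phaseMap j G n x)) 1 = 0 ∧ (∀ y, tsDiv (epsN n) j G P y = 0) ∧ (∀ y, ‖tsResidual (epsN n) j G f P Q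 c y‖ ^ 2 ≤ C * nuN n ^ K))) → Summit.AnomalousDissipation.AnomalousDissipation.Theses.NeutralTaylorWaves.TaylorWaveQuasiSteady :=
  fun hH hHP => TaylorWaveQuasiSteady_of (hHP hH) DissipationLaw.stub_dissipationLawW ResidualTransfer.stub_residualTransferW

end Summit.AnomalousDissipation.AnomalousDissipation.Theorems.TaylorWaveQuasiSteady

end
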